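import Summits.BirchSwinnertonDyer.Rank1Residual.X11b.Three.GoodReductionSubgroupFormalH1
import Summits.BirchSwinnertonDyer.Rank1Residual.X11b.Three.GoodReductionSubgroupInflation
import HarnessLib

/-!
# X11b at `p = 3` (team N8/O2), JET3-KUMMER (α): the non-split node with `[k : k_v]` odd, by
# inflation from the quadratic unramified layer (assembly of parts 8 and 9)

HONEST FRAMING (cell `b2b-bsdres`, run/shared/lean/b2b/bsd-rank1-residual/, verbatim in every
file): the goal of the cell is to DELETE the COMBINATION-SHAPED residual classes of the
Birch–Swinnerton-Dyer formula for ALL analytic-rank `≤ 1` elliptic curves over `ℚ` — "full BSD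
formula for every rank `≤ 1` curve in class `C`" assembled STRICTLY from published theorems — so
that the rank-`≤ 1` remainder becomes exactly the CONSTRUCTION-SHAPED classes, which are TYPED
(missing-input `Prop`s), NOT attempted. This is not "finishing BSD". Team N8/O2 = `x11b3`, seat
`b2b-bsdres-x11b3-p4`, LEAD DEAL #6 A6.2, S15 (ii), part 10. THEOREMS ONLY: no definition, no
named fact, no `sorry`; nothing is booked; `JET@p|N` NOT discharged.

## What

* `cyclicH1_of_node_of_complete` — the CYCLIC form of (α) at a place with a presented node over a
  complete unramified layer (`H¹(⟨φ⟩, E₀(L)) = 0`: every `m ∈ E₀(L)` with `Σ_{j<n} φʲ m = O` is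
  `φ P − P`, `P ∈ E₀(L)`), from `h1ker_of_complete` (part 8) and `h1red_of_node` (part 5) by
  `cyclicH1_of_subset` (part 2). This is the input `h1'` of part 9's inflation.
* **`hα_of_nonsplit_odd`** — p1's hypothesis (α) of `JetchevKummerAtP` for a layer `L/F` at which
  the node is NOT presented over the residue field `k` (non-split multiplicative `v`, `[k : k_v]`
  odd), GIVEN a bigger layer `L' ⊇ L` (the quadratic unramified extension) over which it is: tower
  `F ⊆ L ⊆ L'`, discrete valuation rings `R → R'` local, `R'` complete with finite residue field of
  order `q^{N'}`, `φ' ∈ Aut(L'/F)` the isometric Frobenius generator-power data (`φ'^{N'} = 1`,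
  `x ↦ x^q` on `k'`) restricting to the generator `φ` of `Gal(L/F)` (`φⁿ = 1`, `n ∣ N'`,
  `Fix(φ'ⁿ) = L`), `Aut(L'/F)` preserving `R'`, a uniformiser of `R'` from `F`, `X ⊗ L'` elliptic
  with an `R'`-model whose reduction is `singularModel x₀ y₀ α₁ α₂` (`α₁ ≠ α₂`). Proof:
  part 9 `hα_of_inflation` + `cyclicH1_of_node_of_complete` at `L'`.

With parts 5, 8 (presented node) and this file (non-presented node), (α) is a theorem at EVERY
multiplicative place, modulo the standard instantiation facts of the unramified layers of `ℚ₃`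
(hypotheses here). Milne, *ADT* I.3.8; Serre, *Local Fields* VII §6.

References (locators only; no new fact): [cite: MilneADT2006, Ch. I Prop. 3.8]
[cite: SerreLocalFields1979, VII §6, V §2, XIII §1] [cite: SilvermanAEC2009, VII.2 Prop. 2.1,
Exercise 3.5(a)].

## Design

No definitions; `noncomputable section`; `open scoped Classical NNReal`. Axioms: `propext`,
`Classical.choice`, `Quot.sound`.
-/

noncomputable section

open scoped Classical NNReal

namespace Summit.BirchSwinnertonDyer.Rank1Residual.X11b.Three.JetchevKummer

open WeierstrassCurve Literature.NumberTheory.EllipticCurves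

universe u

section Cyclic

variable {F : Type u} [Field F] (X : WeierstrassCurve F) (L : Type u) [Field L] [Algebra F L]
  (R : Type*) [CommRing R] [IsDomain R] [IsDiscreteValuationRing R] [Algebra R L]
  [IsFractionRing R L] (w : Valuation L ℝ≥0) (hw : w.Integers R)

include hw in
/-- **`H¹(⟨φ⟩, E₀(L)) = 0` in cyclic form at a place with a presented node over a complete
unramified layer**: every `m ∈ E₀(L)` with `Σ_{j<n} φʲ m = O` is `φ P − P` with `P ∈ E₀(L)`
(`h1ker_of_complete` + `h1red_of_node` + `cyclicH1_of_subset`). Milne, *ADT* I.3.8 for `𝒜°` at a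
finite unramified level. [cite: MilneADT2006, Ch. I Prop. 3.8] -/
theorem cyclicH1_of_node_of_complete [IsAdicComplete (IsLocalRing.maximalIdeal R) R]
    [Finite (IsLocalRing.ResidueField R)] [(X.baseChange L).IsElliptic] [(X.baseChange L).IsMinimal R]
    (W₀ : WeierstrassCurve R) (hX : X.baseChange L = W₀.baseChange L)
    (hR : ∀ (τ : L ≃ₐ[F] L) (x : L), x ∈ Set.range (algebraMap R L) →
      τ x ∈ Set.range (algebraMap R L))
    {x₀ y₀ α₁ α₂ : IsLocalRing.ResidueField R}
    (hW : W₀.map (IsLocalRing.residue R) = singularModel x₀ y₀ α₁ α₂) (hα : α₁ ≠ α₂)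
    (φ : L ≃ₐ[F] L) (hφw : ∀ x, w (φ x) = w x) {q n : ℕ} (hn : φ ^ n = 1)
    (hcard : Nat.card (IsLocalRing.ResidueField R) = q ^ n)
    (hfrob : ∀ a : R, ∃ a' : R, algebraMap R L a' = φ (algebraMap R L a) ∧
      IsLocalRing.residue R a' = IsLocalRing.residue R a ^ q)
    {ϖ : R} (hϖ : Irreducible ϖ) {π : F} (hπ : algebraMap F L π = algebraMap R L ϖ) :
    ∀ m ∈ (X.baseChange L).goodReductionSubgroup R, ∑ j ∈ Finset.range n, (φ ^ j) • m = 0 →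
      ∃ P ∈ (X.baseChange L).goodReductionSubgroup R, φ • P - P = m :=
  cyclicH1_of_subset ((X.baseChange L).goodReductionSubgroup R) _
    (fun Q hQ ↦ mem_goodReductionSubgroup_of_reducesToZero X L R Q hQ) hn
    (h1ker_of_complete X L R w hw W₀ hX hR φ hφw hn hcard hfrob hϖ hπ)
    (h1red_of_node X L R W₀ hX hR hW hα φ hcard hfrob)

end Cyclic

section Odd

variable {F : Type u} [Field F] (X : WeierstrassCurve F) (L : Type u) [Field L] [Algebra F L]
  (L' : Type u) [Field L'] [Algebra F L'] [Algebra L L'] [IsScalarTower F L L']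
  (R : Type*) [CommRing R] [IsDomain R] [IsDiscreteValuationRing R] [Algebra R L]
  [IsFractionRing R L]
  (R' : Type*) [CommRing R'] [IsDomain R'] [IsDiscreteValuationRing R'] [Algebra R' L']
  [IsFractionRing R' L']
  [Algebra R R'] [Algebra R L'] [IsScalarTower R R' L'] [IsScalarTower R L L']
  (w' : Valuation L' ℝ≥0) (hw' : w'.Integers R')

include hw' in
/-- **(α) at a non-split node with `[k : k_v]` odd, by inflation from the quadratic unramified
layer.** p1's hypothesis `hα` of `JetchevKummerAtP` for the layer `L` (generator `φ`, `φⁿ = 1`)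
follows from the data of a bigger layer `L' ⊇ L` over which the node IS presented: `R → R'`
local, `R'` complete with finite residue field of order `q^{N'}`, `φ'` (isometry, `φ'^{N'} = 1`,
`x ↦ x^q` on `k'`, restricting to `φ`, `Fix(φ'ⁿ) = L`, `n ∣ N'`), `Aut(L'/F)` preserving `R'`, a
uniformiser of `R'` from `F`, `X ⊗ L'` elliptic with `R'`-model reducing to
`singularModel x₀ y₀ α₁ α₂`, `α₁ ≠ α₂`. Proof: `hα_of_inflation` (part 9) with
`cyclicH1_of_node_of_complete` at `L'`. [cite: MilneADT2006, Ch. I Prop. 3.8]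
[cite: SerreLocalFields1979, VII §6] -/
theorem hα_of_nonsplit_odd [IsLocalHom (algebraMap R R')]
    [(X.baseChange L).IsMinimal R] [(X.baseChange L').IsMinimal R']
    [IsAdicComplete (IsLocalRing.maximalIdeal R') R'] [Finite (IsLocalRing.ResidueField R')]
    [(X.baseChange L').IsElliptic]
    (W₀' : WeierstrassCurve R') (hX' : X.baseChange L' = W₀'.baseChange L')
    (hR' : ∀ (τ : L' ≃ₐ[F] L') (x : L'), x ∈ Set.range (algebraMap R' L') →
      τ x ∈ Set.range (algebraMap R' L'))
    {x₀ y₀ α₁ α₂ : IsLocalRing.ResidueField R'}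
    (hW' : W₀'.map (IsLocalRing.residue R') = singularModel x₀ y₀ α₁ α₂) (hα : α₁ ≠ α₂)
    (φ : L ≃ₐ[F] L) (hφ : ∀ σ : L ≃ₐ[F] L, σ ∈ Subgroup.zpowers φ) {n : ℕ} (hn : φ ^ n = 1)
    (φ' : L' ≃ₐ[F] L') (hcompat : ∀ x : L, φ' (algebraMap L L' x) = algebraMap L L' (φ x))
    (hφ'w : ∀ x, w' (φ' x) = w' x) {q N' : ℕ} (hN' : φ' ^ N' = 1) (hnN : n ∣ N')
    (hcard' : Nat.card (IsLocalRing.ResidueField R') = q ^ N')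
    (hfrob' : ∀ a : R', ∃ a' : R', algebraMap R' L' a' = φ' (algebraMap R' L' a) ∧
      IsLocalRing.residue R' a' = IsLocalRing.residue R' a ^ q)
    (hdesc : ∀ x : L', (φ' ^ n) x = x → x ∈ Set.range (algebraMap L L'))
    {ϖ' : R'} (hϖ' : Irreducible ϖ') {π : F} (hπ : algebraMap F L' π = algebraMap R' L' ϖ') :
    ∀ Q : (X.baseChange L).toAffine.Point,
      (∀ σ : L ≃ₐ[F] L, σ • Q - Q ∈ (X.baseChange L).goodReductionSubgroup R) →
        ∃ Q' : (X.baseChange L).toAffine.Point, (∀ σ : L ≃ₐ[F] L, σ • Q' = Q') ∧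
          Q - Q' ∈ (X.baseChange L).goodReductionSubgroup R :=
  hα_of_inflation X L L' R R' φ hφ hn φ' hcompat hnN hdesc
    (cyclicH1_of_node_of_complete X L' R' w' hw' W₀' hX' hR' hW' hα φ' hφ'w hN' hcard' hfrob'
      hϖ' hπ)

end Odd

end Summit.BirchSwinnertonDyer.Rank1Residual.X11b.Three.JetchevKummer

end
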